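import Mathlib
import Summits.ValiantsHypothesis.ValiantsHypothesis.Theses.OneNatPerBit
import Summits.ValiantsHypothesis.ValiantsHypothesis.Theorems.FreeFermionCLLExpImpliesGap
import Literature.Computability.AlgebraicComplexity.PermanentCorrelation
import Literature.Computability.AlgebraicComplexity.CircuitDepth

/-!
# `CorrelationGap` split along the Agrawal–Vinay / Tavenas seam (alternative decomposition D1″)

Route `ValiantsHypothesis/OneNatPerBit`, crux `CorrelationGap` (stmt-ValiantsHypothesis-10315).
Crux-strategist ALTERNATIVE decomposition, kernel-checked assembly:

    Depth4Form → Depth4AngleLaw → CorrelationGap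

* `Depth4Form` (piece 1, a THEOREM: Tavenas 2015 Thm. 1 / Agrawal–Vinay 2008, in the tree's
  product-depth model, PROVED family-level as `productDepthCircuitSize_two_le_of_isVPFamily_holds`;
  here per polynomial, for the degree-`n` component): the degree-`n` component of the output of a
  size-`n^c` fan-in-two circuit has a product-depth-`≤ 2` (`ΣΠΣΠ`) circuit with at most
  `(n + 2)^(C·⌊√n⌋ + C)` gates.
* `Depth4AngleLaw` (piece 2, OPEN, new): `‖permMass([deg n] F.eval)‖² ≤ C·(size F + n + 1)^C·θⁿ·
  n!·coeffNormSq([deg n] F.eval)` for every product-depth-`≤ 2` circuit `F` — size buys correlation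
  with `per_n` only polynomially against an exponential deficit, at depth four.  It is IMPLIED (up to
  the constant) by the ABP / total-rank laws (a `ΣΠΣΠ` circuit of size `s` has degree-`n` component
  with ABPs of width `poly(s, n)`), hence WEAKER than `FreeFermionCLL.ExpRankLaw`, and still closes
  the crux because `((n+2)^(C√n + C))^C'·θⁿ → 0` (`eventually_subexp_mul_geom_le_one` below).
-/

-- single-conjunct layout: Sub = Summit, duplicated namespace component intended
set_option linter.dupNamespace false

namespace Summit.ValiantsHypothesis.ValiantsHypothesis.Cruxes.CorrelationGap.Depth4Seam

open Filter Topology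
open MvPolynomial Literature.Computability.AlgebraicComplexity
open scoped Matrix BigOperators

/-! ### Real analysis: `exp(-εn)` beats `(n+2)^{O(√n)}` -/

/-- `log (n + 2) / √(n + 2) → 0`. [folklore] -/
theorem tendsto_log_div_sqrt_add_two_atTop :
    Tendsto (fun n : ℕ => Real.log ((n : ℝ) + 2) / Real.sqrt ((n : ℝ) + 2)) atTop (𝓝 0) := by
  have h := (isLittleO_log_rpow_atTop (by norm_num : (0 : ℝ) < 1 / 2)).tendsto_div_nhds_zero
  have h' := h.comp (tendsto_atTop_add_const_right atTop (2 : ℝ) tendsto_natCast_atTop_atTop)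
  refine h'.congr fun n => ?_
  simp only [Function.comp_apply, Real.sqrt_eq_rpow]

/-- `(C₁·⌊√n⌋ + C₁)·log(n + 2) / n → 0`: the exponent of Tavenas' size bound is `o(n / log n)`.
[folklore] -/
theorem tendsto_sqrtExp_mul_log_div_atTop (C₁ : ℕ) :
    Tendsto (fun n : ℕ => (((C₁ * Nat.sqrt n + C₁ : ℕ) : ℝ) * Real.log ((n : ℝ) + 2)) / (n : ℝ))
      atTop (𝓝 0) := by
  have h1 : Tendsto (fun n : ℕ => 4 * (C₁ : ℝ) *
      (Real.log ((n : ℝ) + 2) / Real.sqrt ((n : ℝ) + 2))) atTop (𝓝 0) := by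
    simpa using tendsto_log_div_sqrt_add_two_atTop.const_mul (4 * (C₁ : ℝ))
  refine tendsto_of_tendsto_of_tendsto_of_le_of_le' tendsto_const_nhds h1 ?_ ?_
  · filter_upwards with n
    have : 0 ≤ Real.log ((n : ℝ) + 2) := Real.log_nonneg (by linarith [n.cast_nonneg (α := ℝ)])
    positivity
  · filter_upwards [eventually_ge_atTop 2] with n hn
    have hn2 : (2 : ℝ) ≤ n := by exact_mod_cast hn
    have hn0 : (0 : ℝ) < n := by linarith
    have hlog : 0 ≤ Real.log ((n : ℝ) + 2) := Real.log_nonneg (by linarith)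
    set S : ℝ := Real.sqrt ((n : ℝ) + 2) with hS
    have hS0 : 0 < S := Real.sqrt_pos.2 (by linarith)
    have hSS : S * S = (n : ℝ) + 2 := Real.mul_self_sqrt (by linarith)
    have h1S : 1 ≤ S := by
      rw [hS, show (1 : ℝ) = Real.sqrt 1 from Real.sqrt_one.symm]
      exact Real.sqrt_le_sqrt (by linarith)
    -- the Tavenas exponent is at most `2 C₁ √(n+2)`
    have hb : (((C₁ * Nat.sqrt n + C₁ : ℕ) : ℝ)) ≤ 2 * (C₁ : ℝ) * S := by
      have hsq : ((Nat.sqrt n : ℕ) : ℝ) ≤ S :=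
        (Real.nat_sqrt_le_real_sqrt).trans (Real.sqrt_le_sqrt (by linarith))
      have hC : (0 : ℝ) ≤ C₁ := C₁.cast_nonneg
      push_cast
      nlinarith
    -- and `√(n+2) / n ≤ 2 / √(n+2)` for `n ≥ 2`
    have hkey : S * Real.log ((n : ℝ) + 2) / n ≤ 2 * (Real.log ((n : ℝ) + 2) / S) := by
      have hprod : S * S * Real.log ((n : ℝ) + 2) ≤ 2 * n * Real.log ((n : ℝ) + 2) := by
        rw [hSS]
        nlinarith
      rw [div_le_iff₀ hn0, show 2 * (Real.log ((n : ℝ) + 2) / S) * n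
          = (2 * n * Real.log ((n : ℝ) + 2)) / S by ring, le_div_iff₀ hS0]
      calc S * Real.log ((n : ℝ) + 2) * S = S * S * Real.log ((n : ℝ) + 2) := by ring
        _ ≤ 2 * n * Real.log ((n : ℝ) + 2) := hprod
    calc (((C₁ * Nat.sqrt n + C₁ : ℕ) : ℝ) * Real.log ((n : ℝ) + 2)) / (n : ℝ)
        ≤ (2 * (C₁ : ℝ) * S * Real.log ((n : ℝ) + 2)) / (n : ℝ) := by gcongr
      _ = 2 * (C₁ : ℝ) * (S * Real.log ((n : ℝ) + 2) / n) := by ring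
      _ ≤ 2 * (C₁ : ℝ) * (2 * (Real.log ((n : ℝ) + 2) / S)) := by gcongr
      _ = 4 * (C₁ : ℝ) * (Real.log ((n : ℝ) + 2) / S) := by ring

/-- **Exponential decay beats Tavenas' `(n+2)^{O(√n)}`**: for `0 < θ < 1` and all `C C₁ : ℕ`,
`2·C·((n+2)^(C₁⌊√n⌋ + C₁) + n + 1)^C·θⁿ ≤ 1` for all sufficiently large `n`. [folklore] -/
theorem eventually_subexp_mul_geom_le_one (C C₁ : ℕ) {θ : ℝ} (hθ0 : 0 < θ) (hθ1 : θ < 1) :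
    ∃ n₀ : ℕ, ∀ n ≥ n₀,
      2 * (C : ℝ) * (((n : ℝ) + 2) ^ (C₁ * Nat.sqrt n + C₁) + n + 1) ^ C * θ ^ n ≤ 1 := by
  set b : ℕ → ℕ := fun n => C₁ * Nat.sqrt n + C₁ with hb
  set E : ℕ → ℝ := fun n =>
    (C : ℝ) * (b n : ℝ) * Real.log ((n : ℝ) + 2) + C * Real.log ((n : ℝ) + 2) + n * Real.log θ
    with hE
  have hθlog : Real.log θ < 0 := Real.log_neg hθ0 hθ1
  -- the bracket tends to `log θ < 0`
  have hinner : Tendsto (fun n : ℕ => (C : ℝ) * (((b n : ℝ) * Real.log ((n : ℝ) + 2)) / n)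
      + C * (Real.log ((n : ℝ) + 2) / n) + Real.log θ) atTop (𝓝 (Real.log θ)) := by
    have h1 := (tendsto_sqrtExp_mul_log_div_atTop C₁).const_mul (C : ℝ)
    have h2 := Theorems.FreeFermionCLL.tendsto_log_add_two_div_atTop.const_mul (C : ℝ)
    have h3 := (h1.add h2).add_const (Real.log θ)
    simpa [hb] using h3
  -- hence the exponent tends to `-∞`
  have hE' : Tendsto E atTop atBot := by
    have h := tendsto_natCast_atTop_atTop.atTop_mul_neg hθlog hinner
    refine h.congr' ?_
    filter_upwards [eventually_ge_atTop 1] with n hn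
    have hn0 : (n : ℝ) ≠ 0 := by exact_mod_cast (by omega : n ≠ 0)
    simp only [hE]
    field_simp
  have hg : Tendsto (fun n => 2 * (C : ℝ) * Real.exp (E n)) atTop (𝓝 0) := by
    simpa using (Real.tendsto_exp_atBot.comp hE').const_mul (2 * (C : ℝ))
  obtain ⟨n₀, hn₀⟩ := eventually_atTop.1 (hg.eventually_lt_const one_pos)
  refine ⟨max n₀ 1, fun n hn => ?_⟩
  have hlt := hn₀ n (le_of_max_le_left hn)
  refine le_trans ?_ hlt.le
  -- `f n ≤ 2 C exp (E n)`
  have hB : (0 : ℝ) < (n : ℝ) + 2 := by positivity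
  have h2a : (1 : ℝ) ≤ ((n : ℝ) + 2) ^ b n := one_le_pow₀ (by linarith)
  have hn0 : (0 : ℝ) ≤ n := n.cast_nonneg
  have hbase : ((n : ℝ) + 2) ^ b n + n + 1 ≤ ((n : ℝ) + 2) ^ b n * ((n : ℝ) + 2) := by nlinarith
  have e1 : Real.exp ((C : ℝ) * (b n : ℝ) * Real.log ((n : ℝ) + 2)) =
      (((n : ℝ) + 2) ^ b n) ^ C := by
    rw [← pow_mul, ← Real.exp_log (pow_pos hB (b n * C)), Real.log_pow]
    push_cast
    ring_nf
  have e2 : Real.exp ((C : ℝ) * Real.log ((n : ℝ) + 2)) = ((n : ℝ) + 2) ^ C := by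
    rw [Real.exp_nat_mul, Real.exp_log hB]
  have e3 : Real.exp ((n : ℝ) * Real.log θ) = θ ^ n := by
    rw [Real.exp_nat_mul, Real.exp_log hθ0]
  have hexp : Real.exp (E n) = (((n : ℝ) + 2) ^ b n) ^ C * ((n : ℝ) + 2) ^ C * θ ^ n := by
    simp only [hE, Real.exp_add, e1, e2, e3]
  calc 2 * (C : ℝ) * (((n : ℝ) + 2) ^ b n + n + 1) ^ C * θ ^ n
      ≤ 2 * (C : ℝ) * (((n : ℝ) + 2) ^ b n * ((n : ℝ) + 2)) ^ C * θ ^ n := by gcongr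
    _ = 2 * (C : ℝ) * Real.exp (E n) := by rw [hexp, mul_pow]; ring

/-! ### The functional only sees the degree-`n` component -/

/-- A permutation monomial has degree `n`. [folklore] -/
theorem degree_permMonomial {n : ℕ} (ρ : Equiv.Perm (Fin n)) : (permMonomial ρ).degree = n := by
  rw [Finsupp.degree_eq_sum, Fintype.sum_prod_type]
  have h : ∀ r : Fin n, ∑ c, permMonomial ρ (r, c) = 1 := fun r => rowCount_permMonomial ρ r
  simp_rw [h]
  simp

/-- `permMass n f^(n) = permMass n f`. [folklore] -/
theorem permMass_homogeneousComponent {n : ℕ} (f : MvPolynomial (Fin n × Fin n) ℂ) :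
    permMass n (homogeneousComponent n f) = permMass n f := by
  rw [permMass_def, permMass_def]
  refine Finset.sum_congr rfl fun σ _ => ?_
  rw [coeff_homogeneousComponent, if_pos (degree_permMonomial σ)]

/-- `coeffNormSq n f^(n) ≤ coeffNormSq n f`. [folklore] -/
theorem coeffNormSq_homogeneousComponent_le {n : ℕ} (f : MvPolynomial (Fin n × Fin n) ℂ) :
    coeffNormSq n (homogeneousComponent n f) ≤ coeffNormSq n f := by
  rw [coeffNormSq_def, coeffNormSq_def]
  have hcoeff : ∀ m ∈ (homogeneousComponent n f).support,
      coeff m (homogeneousComponent n f) = coeff m f := by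
    intro m hm
    rw [mem_support_iff, coeff_homogeneousComponent] at hm
    rw [coeff_homogeneousComponent]
    by_cases h : m.degree = n
    · rw [if_pos h]
    · rw [if_neg h] at hm
      exact absurd rfl hm
  have hsub : (homogeneousComponent n f).support ⊆ f.support := by
    intro m hm
    have hc := hcoeff m hm
    rw [mem_support_iff] at hm ⊢
    rwa [hc] at hm
  calc ∑ m ∈ (homogeneousComponent n f).support, ‖coeff m (homogeneousComponent n f)‖ ^ 2
        = ∑ m ∈ (homogeneousComponent n f).support, ‖coeff m f‖ ^ 2 :=
          Finset.sum_congr rfl fun m hm => by rw [hcoeff m hm]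
    _ ≤ ∑ m ∈ f.support, ‖coeff m f‖ ^ 2 :=
          Finset.sum_le_sum_of_subset_of_nonneg hsub fun m _ _ => sq_nonneg _

/-- The degree-`n` component is its own degree-`n` component. [folklore] -/
theorem homogeneousComponent_idem {n : ℕ} (f : MvPolynomial (Fin n × Fin n) ℂ) :
    homogeneousComponent n (homogeneousComponent n f) = homogeneousComponent n f := by
  rw [homogeneousComponent_of_mem (homogeneousComponent_mem n f), if_pos rfl]

/-! ### The assembly -/

/-- **Assembly of the Tavenas split of `CorrelationGap`**: `Depth4Form → Depth4AngleLaw →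
CorrelationGap` (both hypotheses spelled out; the conclusion is the route decl). -/
theorem CorrelationGap_of_depth4
    (h₁ : ∀ c : ℕ, ∃ C n₀ : ℕ, ∀ n ≥ n₀,
      ∀ P : Literature.Computability.AlgebraicComplexity.ArithCircuit ℂ (Fin n × Fin n),
        P.IsFanInTwo → P.size ≤ n ^ c →
          ∃ F : Literature.Computability.AlgebraicComplexity.ArithCircuit ℂ (Fin n × Fin n),
            F.productDepth ≤ 2 ∧ F.size ≤ (n + 2) ^ (C * Nat.sqrt n + C) ∧
              F.eval = MvPolynomial.homogeneousComponent n P.eval)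
    (h₂ : ∃ (C : ℕ) (θ : ℝ), 0 < θ ∧ θ < 1 ∧ ∀ (n : ℕ)
      (F : Literature.Computability.AlgebraicComplexity.ArithCircuit ℂ (Fin n × Fin n)),
        F.productDepth ≤ 2 →
          ‖Literature.Computability.AlgebraicComplexity.permMass n
              (MvPolynomial.homogeneousComponent n F.eval)‖ ^ 2 ≤
            (C : ℝ) * ((F.size : ℝ) + n + 1) ^ C * θ ^ n *
              ((n.factorial : ℝ) * Literature.Computability.AlgebraicComplexity.coeffNormSq n
                (MvPolynomial.homogeneousComponent n F.eval))) :
    Summit.ValiantsHypothesis.ValiantsHypothesis.Theses.OneNatPerBit.CorrelationGap := by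
  obtain ⟨C, θ, hθ0, hθ1, hlaw⟩ := h₂
  intro c
  obtain ⟨C₁, n₁, hform⟩ := h₁ c
  obtain ⟨n₂, hn₂⟩ := eventually_subexp_mul_geom_le_one C C₁ hθ0 hθ1
  refine ⟨max n₁ n₂, fun n hn P hfan hsize => ?_⟩
  obtain ⟨F, hdepth, hFsize, hFeval⟩ := hform n ((le_max_left _ _).trans hn) P hfan hsize
  have hkey := hn₂ n ((le_max_right _ _).trans hn)
  have hL := hlaw n F hdepth
  rw [hFeval, homogeneousComponent_idem] at hL
  set g : MvPolynomial (Fin n × Fin n) ℂ := MvPolynomial.homogeneousComponent n P.eval with hg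
  -- the target in the vocabulary of `PermanentCorrelation.lean` (definitional)
  change 2 * ‖permMass n P.eval‖ ^ 2 ≤ (n.factorial : ℝ) * coeffNormSq n P.eval
  rw [← permMass_homogeneousComponent P.eval]
  have hN : 0 ≤ (n.factorial : ℝ) * coeffNormSq n g :=
    mul_nonneg (Nat.cast_nonneg _) (coeffNormSq_nonneg _)
  have hs : ((F.size : ℝ) + n + 1) ≤ ((n : ℝ) + 2) ^ (C₁ * Nat.sqrt n + C₁) + n + 1 := by
    have : (F.size : ℝ) ≤ ((n : ℝ) + 2) ^ (C₁ * Nat.sqrt n + C₁) := by exact_mod_cast hFsize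
    linarith
  have hθn : 0 ≤ θ ^ n := pow_nonneg hθ0.le n
  calc 2 * ‖permMass n g‖ ^ 2
      ≤ 2 * ((C : ℝ) * ((F.size : ℝ) + n + 1) ^ C * θ ^ n * ((n.factorial : ℝ) * coeffNormSq n g)) :=
        by linarith
    _ = (2 * (C : ℝ) * ((F.size : ℝ) + n + 1) ^ C * θ ^ n) * ((n.factorial : ℝ) * coeffNormSq n g) :=
        by ring
    _ ≤ (2 * (C : ℝ) * (((n : ℝ) + 2) ^ (C₁ * Nat.sqrt n + C₁) + n + 1) ^ C * θ ^ n) *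
          ((n.factorial : ℝ) * coeffNormSq n g) := by gcongr
    _ ≤ 1 * ((n.factorial : ℝ) * coeffNormSq n g) := by gcongr
    _ = (n.factorial : ℝ) * coeffNormSq n g := one_mul _
    _ ≤ (n.factorial : ℝ) * coeffNormSq n P.eval :=
        mul_le_mul_of_nonneg_left (coeffNormSq_homogeneousComponent_le _) (Nat.cast_nonneg _)

end Summit.ValiantsHypothesis.ValiantsHypothesis.Cruxes.CorrelationGap.Depth4Seam
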